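import Summits.Parity.BatemanHorn.Theorems.NormalFamilyBound.Negative.RealAxis

/-!
# Crux `NormalFamilyBound` (stmt-Parity-9769), line `Sketch` (renewal-phase-bootstrap): stub `stub_negativeAnchorTransfer`

The NEGATIVE-ANCHOR TRANSFER on the near-zero box: arc barrier + real-segment parity + phase-velocity
upper bound give one bound for `H_x(z)`, `x ≥ 3`, on `{−η < Re z ≤ 0, |Im z| < η}`.
Everything here is PROVED (supports stmt-Parity-9769; registered stub of the line skeleton
`Cruxes/NormalFamilyBound/Lines/Sketch.lean`). Vocabulary `Ωf`, `H` of
`Theorems/NormalFamilyBound/Negative/RealAxis.lean`. The file is self-contained (Mathlib + `RealAxis`);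
it is the mirror image, on `Re z ≤ 0`, of the R+ bootstrap transfer
`SelbergDelangeRigidityNormalFamilyBoundBootstrapTransfer.lean`.

Proof layout: `S_x(w) = Σ_{n ≤ x} w^{Ω_f(n)}` is the polynomial `P = Σ_{n ≤ x} X^{Ω_f(n)}` evaluated at `w`
and `w P'(w) = Σ Ω_f(n) w^{Ω_f(n)}`; a bound `‖S_x(z)‖ ≤ A x (log x)^{k(Re z − 1)}` is exactly `‖H_x(z)‖ ≤ A`
(`negativeAnchorTransfer_norm_H_le`). By conjugation WLOG `Im z ≤ 0`; `t = |z| < 2η`. If `Im z = 0` then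
`z = −t` and real-segment parity bounds `‖S_x(−t)‖` directly. If `Im z < 0` then `z = t e^{iψ}` with
`−π < ψ ≤ −π/2`, and the arc `φ ↦ t e^{iφ}`, `−π ≤ φ ≤ ψ`, starts at `−t`; along it the barrier
`b(φ) = log(max(C₀,1) x) + k (t cos φ − 1) log log x + C⁺ (φ + π)` starts above `‖S_x(−t)‖` (parity) and
its slope dominates `−Im(w P'/P)` wherever `‖P‖ > e^{b}` (phase-velocity upper bound, whose proviso
`‖S_x‖ ≥ e^{−K} x (log x)^{k(t cos φ − 1)}` holds above the barrier). The arc barrier hypothesis gives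
`‖S_x(z)‖ ≤ e^{b(ψ)}`, i.e. `‖H_x(z)‖ ≤ max(C₀,1) e^{C⁺ π}` because `t cos ψ = Re z`. Finally `z = 0` follows
by continuity of `H_x` along the negative real axis.
-/

namespace Summit.Parity.BatemanHorn.Cruxes.NormalFamilyBound.RenewalPhaseBootstrap

open Literature.NumberTheory.Sieve Polynomial Finset Filter
open Summit.Parity.BatemanHorn.Theorems.NormalFamilyBound.Negative
open scoped Topology

noncomputable section

/-! ## Elementary lemmas -/

/-- `H_x` is an entire (in particular continuous) function of `z`. -/
theorem negativeAnchorTransfer_continuous_H (k : ℕ) (f : Fin k → ℤ[X]) (x : ℕ) :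
    Continuous (H k f x) := by
  unfold H
  fun_prop

/-- Conjugation does not change `‖H_x(z)‖` (all coefficients of the family are real). -/
theorem negativeAnchorTransfer_norm_H_conj (k : ℕ) (f : Fin k → ℤ[X]) (x : ℕ) (z : ℂ) :
    ‖H k f x ((starRingEnd ℂ) z)‖ = ‖H k f x z‖ := by
  have h : H k f x ((starRingEnd ℂ) z) = (starRingEnd ℂ) (H k f x z) := by
    simp only [H, map_mul, map_inv₀, map_natCast, map_sum, map_pow, ← Complex.exp_conj, map_sub,
      map_one, Complex.conj_ofReal]
  rw [h, Complex.norm_conj]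

/-- From S to H: a bound `‖S_x(z)‖ ≤ A · x (log x)^{k(Re z − 1)}` on `S_x(z) = Σ_{n ≤ x} z^{Ω_f(n)}`
(the power of `log x` written with `exp`) is the bound `‖H_x(z)‖ ≤ A`. -/
theorem negativeAnchorTransfer_norm_H_le (k : ℕ) (f : Fin k → ℤ[X]) {x : ℕ} (hx : (0 : ℝ) < x)
    (z : ℂ) {A : ℝ}
    (h : ‖∑ n ∈ Finset.range (x + 1), z ^ Ωf f n‖ ≤
      A * (x * Real.exp (Real.log (Real.log x) * ((k : ℝ) * (z.re - 1))))) :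
    ‖H k f x z‖ ≤ A := by
  have hH : H k f x z = (x : ℂ)⁻¹ * Complex.exp ((k : ℂ) * (1 - z) * (Real.log (Real.log x) : ℂ)) *
      ∑ n ∈ Finset.range (x + 1), z ^ Ωf f n := rfl
  have hn : ‖Complex.exp ((k : ℂ) * (1 - z) * (Real.log (Real.log x) : ℂ))‖ =
      Real.exp ((k : ℝ) * (1 - z.re) * Real.log (Real.log x)) := by
    rw [Complex.norm_exp]
    congr 1
    simp only [Complex.mul_re, Complex.mul_im, Complex.sub_re, Complex.sub_im, Complex.one_re,
      Complex.one_im, Complex.ofReal_re, Complex.ofReal_im, Complex.natCast_re, Complex.natCast_im]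
    ring
  have hexp1 : Real.exp ((k : ℝ) * (1 - z.re) * Real.log (Real.log x)) *
      Real.exp (Real.log (Real.log x) * ((k : ℝ) * (z.re - 1))) = 1 := by
    rw [← Real.exp_add, Real.exp_eq_one_iff]; ring
  rw [hH, norm_mul, norm_mul, norm_inv, Complex.norm_natCast, hn]
  calc (x : ℝ)⁻¹ * Real.exp ((k : ℝ) * (1 - z.re) * Real.log (Real.log x)) *
        ‖∑ n ∈ Finset.range (x + 1), z ^ Ωf f n‖
      ≤ (x : ℝ)⁻¹ * Real.exp ((k : ℝ) * (1 - z.re) * Real.log (Real.log x)) *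
          (A * (x * Real.exp (Real.log (Real.log x) * ((k : ℝ) * (z.re - 1))))) :=
        mul_le_mul_of_nonneg_left h (by positivity)
    _ = A * ((x : ℝ)⁻¹ * x) * (Real.exp ((k : ℝ) * (1 - z.re) * Real.log (Real.log x)) *
          Real.exp (Real.log (Real.log x) * ((k : ℝ) * (z.re - 1)))) := by ring
    _ = A := by rw [hexp1, inv_mul_cancel₀ hx.ne', mul_one, mul_one]

/-- `e^{−iπ} = −1`. -/
theorem negativeAnchorTransfer_exp_neg_pi_mul_I :
    Complex.exp (((-Real.pi : ℝ) : ℂ) * Complex.I) = -1 := by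
  rw [Complex.ofReal_neg, neg_mul, Complex.exp_neg, Complex.exp_pi_mul_I, inv_neg, inv_one]

/-- A point of the left box `{−η < Re z ≤ 0, |Im z| < η}` has modulus `< 2η` (indeed `≤ η√2`). -/
theorem negativeAnchorTransfer_norm_lt {z : ℂ} {η : ℝ} (hz0 : -η < z.re) (hz1 : z.re ≤ 0)
    (hzim : |z.im| < η) : ‖z‖ < 2 * η := by
  have h2 : ‖z‖ ^ 2 = z.re ^ 2 + z.im ^ 2 := by
    rw [Complex.sq_norm, Complex.normSq_apply]; ring
  have him := abs_lt.mp hzim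
  have hlt : ‖z‖ ^ 2 < (2 * η) ^ 2 := by
    nlinarith [mul_pos (show 0 < η + z.re by linarith) (show 0 < η - z.re by linarith),
      mul_pos (show 0 < η - z.im by linarith) (show 0 < η + z.im by linarith)]
  exact lt_of_pow_lt_pow_left₀ 2 (by linarith) hlt

/-- On `(−π, −π/2]` the sine is nonpositive and nonincreasing: for `−π < φ ≤ ψ ≤ −π/2`,
`sin ψ ≤ sin φ ≤ 0`. -/
theorem negativeAnchorTransfer_sin {φ ψ : ℝ} (hφ0 : -Real.pi < φ) (hφψ : φ ≤ ψ)
    (hψ : ψ ≤ -(Real.pi / 2)) : Real.sin ψ ≤ Real.sin φ ∧ Real.sin φ ≤ 0 := by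
  have h1 : Real.sin φ = -Real.sin (φ + Real.pi) := by rw [Real.sin_add_pi, neg_neg]
  have h2 : Real.sin ψ = -Real.sin (ψ + Real.pi) := by rw [Real.sin_add_pi, neg_neg]
  have h3 : Real.sin (φ + Real.pi) ≤ Real.sin (ψ + Real.pi) :=
    Real.sin_le_sin_of_le_of_le_pi_div_two (by linarith [Real.pi_pos]) (by linarith) (by linarith)
  have h4 : 0 ≤ Real.sin (φ + Real.pi) :=
    Real.sin_nonneg_of_nonneg_of_le_pi (by linarith) (by linarith [Real.pi_pos])
  constructor <;> linarith

/-! ## The transfer -/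

/-- STUB (provable now): the NEGATIVE-ANCHOR TRANSFER on the near-zero box. The arc barrier lemma, real-segment parity
for `t < 2η` and the phase-velocity upper bound give ONE bound `‖H_x(z)‖ ≤ M` for all `x ≥ 3` on the left box
`{−η < Re z ≤ 0, |Im z| < η}` (every `z ≠ 0` there is `te^{iφ}` with `t < η√2 < 2η`, `π/2 ≤ |φ| ≤ π`; by the conjugation
symmetry `S_x(z̄) = conj S_x(z)` one may take `Im z ≤ 0` and run the arc `ψ ↦ te^{iψ}` UP from `ψ = -π` (the point `−t`,
where parity gives the start value) with barrier `b(ψ) = log(max(C₀,1) x) + k(t cos ψ − 1) log log x + C⁺(ψ + π)`;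
`z = 0` follows by continuity of the entire `H_x`). -/
theorem stub_negativeAnchorTransfer :
    (∀ (P : Polynomial ℂ) (r φ₀ φ₁ : ℝ) (b b' : ℝ → ℝ), 0 < r → φ₀ ≤ φ₁ →
      (∀ φ ∈ Set.Icc φ₀ φ₁, HasDerivAt b (b' φ) φ) →
      ‖P.eval ((r : ℂ) * Complex.exp ((φ₀ : ℂ) * Complex.I))‖ ≤ Real.exp (b φ₀) →
      (∀ φ ∈ Set.Ioo φ₀ φ₁,
        Real.exp (b φ) < ‖P.eval ((r : ℂ) * Complex.exp ((φ : ℂ) * Complex.I))‖ →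
          -(((r : ℂ) * Complex.exp ((φ : ℂ) * Complex.I) *
              (Polynomial.derivative P).eval ((r : ℂ) * Complex.exp ((φ : ℂ) * Complex.I)) /
              P.eval ((r : ℂ) * Complex.exp ((φ : ℂ) * Complex.I))).im) ≤ b' φ) →
      ∀ φ ∈ Set.Icc φ₀ φ₁, ‖P.eval ((r : ℂ) * Complex.exp ((φ : ℂ) * Complex.I))‖ ≤ Real.exp (b φ)) →
    ∀ (k : ℕ) (f : Fin k → ℤ[X]) (η C₀ C K : ℝ), 0 < η → η ≤ 1 / 4 → 0 ≤ K →
      (∀ x : ℕ, 3 ≤ x → ∀ t : ℝ, 0 < t → t < 2 * η →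
        ‖∑ n ∈ Finset.range (x + 1), (-(t : ℂ)) ^ Ωf f n‖ ≤ C₀ * x * Real.log x ^ (-((k : ℝ) * (1 + t)))) →
      (∀ x : ℕ, 3 ≤ x → ∀ t φ : ℝ, 0 < t → t < 2 * η → Real.pi / 2 ≤ |φ| → |φ| ≤ Real.pi →
        |t * Real.sin φ| < η →
        Real.exp (-K) * x * Real.log x ^ ((k : ℝ) * (t * Real.cos φ - 1)) ≤
          ‖∑ n ∈ Finset.range (x + 1), ((t : ℂ) * Complex.exp ((φ : ℂ) * Complex.I)) ^ Ωf f n‖ →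
        Real.sign φ *
            ((∑ n ∈ Finset.range (x + 1), (Ωf f n : ℂ) * ((t : ℂ) * Complex.exp ((φ : ℂ) * Complex.I)) ^ Ωf f n) /
              (∑ n ∈ Finset.range (x + 1), ((t : ℂ) * Complex.exp ((φ : ℂ) * Complex.I)) ^ Ωf f n)).im ≤
          (k : ℝ) * t * |Real.sin φ| * Real.log (Real.log x) + C) →
      ∃ M : ℝ, ∀ x : ℕ, 3 ≤ x → ∀ z : ℂ, -η < z.re → z.re ≤ 0 → |z.im| < η → ‖H k f x z‖ ≤ M := by
  intro hArc k f η C₀ C K hη _hη4 hK hP hUB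
  -- constants
  set Cp := max C 0 with hCpdef
  set C₀' := max C₀ 1 with hC₀'def
  have hCp0 : 0 ≤ Cp := le_max_right _ _
  have hCCp : C ≤ Cp := le_max_left _ _
  have hC₀'1 : 1 ≤ C₀' := le_max_right _ _
  have hC₀C₀' : C₀ ≤ C₀' := le_max_left _ _
  have hC₀'0 : 0 ≤ C₀' := zero_le_one.trans hC₀'1
  have hCpπ : 1 ≤ Real.exp (Cp * Real.pi) := Real.one_le_exp (mul_nonneg hCp0 Real.pi_pos.le)
  refine ⟨C₀' * Real.exp (Cp * Real.pi), ?_⟩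
  intro x hx
  -- logarithms
  have hx3 : (3 : ℝ) ≤ x := by exact_mod_cast hx
  have hx0 : (0 : ℝ) < x := by linarith
  have hlog1 : 1 < Real.log x := by
    rw [Real.lt_log_iff_exp_lt hx0]
    have := Real.exp_one_lt_d9
    linarith
  have hlog0 : 0 < Real.log x := by linarith
  set L := Real.log (Real.log x) with hLdef
  have hL : 0 < L := Real.log_pos hlog1
  have hC₀'x : 0 < C₀' * x := mul_pos (by linarith) hx0
  -- the bound at every point `z ≠ 0` of the box
  have key : ∀ z : ℂ, z ≠ 0 → -η < z.re → z.re ≤ 0 → |z.im| < η →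
      ‖H k f x z‖ ≤ C₀' * Real.exp (Cp * Real.pi) := by
    intro z hz hz0 hz1 hzim
    -- WLOG `Im z ≤ 0` (conjugation symmetry of the family)
    wlog him : z.im ≤ 0 generalizing z
    · have h := this ((starRingEnd ℂ) z) (by simpa using hz) (by simpa using hz0)
        (by simpa using hz1) (by simpa using hzim)
        (by rw [Complex.conj_im]; linarith [not_le.mp him])
      rwa [negativeAnchorTransfer_norm_H_conj] at h
    -- the radius `t = |z| ∈ (0, 2η)`
    set t := ‖z‖ with htdef
    have ht : 0 < t := norm_pos_iff.mpr hz
    have ht2 : t < 2 * η := negativeAnchorTransfer_norm_lt hz0 hz1 hzim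
    -- the polynomial `P = Σ_{n ≤ x} X^{Ω_f(n)}`: `S_x = P(·)` and `w P'(w) = Σ Ω_f(n) w^{Ω_f(n)}`
    set P : ℂ[X] := ∑ n ∈ Finset.range (x + 1), (X : ℂ[X]) ^ Ωf f n with hPdef
    have heval : ∀ w : ℂ, P.eval w = ∑ n ∈ Finset.range (x + 1), w ^ Ωf f n := by
      intro w
      simp only [hPdef, eval_finsetSum, eval_pow, eval_X]
    have hderiv : ∀ w : ℂ, w * (derivative P).eval w =
        ∑ n ∈ Finset.range (x + 1), (Ωf f n : ℂ) * w ^ Ωf f n := by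
      intro w
      rw [hPdef, derivative_sum, eval_finsetSum, Finset.mul_sum]
      refine Finset.sum_congr rfl fun n _ => ?_
      rw [derivative_X_pow, eval_mul, eval_C, eval_pow, eval_X]
      rcases Nat.eq_zero_or_pos (Ωf f n) with h | h
      · rw [h]
        simp
      · rw [mul_left_comm, mul_pow_sub_one h.ne']
    -- the barrier
    set b : ℝ → ℝ := fun φ => Real.log (C₀' * x) + L * ((k : ℝ) * (t * Real.cos φ - 1)) +
      Cp * (φ + Real.pi) with hbdef
    set b' : ℝ → ℝ := fun φ => -((k : ℝ) * t * Real.sin φ * L) + Cp with hb'def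
    have hexpb : ∀ φ : ℝ, Real.exp (b φ) =
        C₀' * x * Real.exp (L * ((k : ℝ) * (t * Real.cos φ - 1))) *
          Real.exp (Cp * (φ + Real.pi)) := by
      intro φ
      simp only [hbdef]
      rw [Real.exp_add, Real.exp_add, Real.exp_log hC₀'x]
    have hbder : ∀ φ : ℝ, HasDerivAt b (b' φ) φ := by
      intro φ
      have h1 : HasDerivAt (fun φ : ℝ => t * Real.cos φ - 1) (t * -Real.sin φ) φ :=
        ((Real.hasDerivAt_cos φ).const_mul t).sub_const 1
      have h2 : HasDerivAt (fun φ : ℝ => φ + Real.pi) 1 φ := (hasDerivAt_id' φ).add_const Real.pi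
      have h3 := (((h1.const_mul (k : ℝ)).const_mul L).const_add (Real.log (C₀' * x))).fun_add
        (h2.const_mul Cp)
      simp only [hbdef, hb'def]
      exact h3.congr_deriv (by ring)
    -- the start of the arc: the negative real point `t e^{-iπ} = -t`, bounded by real-segment parity
    have hw₀ : (t : ℂ) * Complex.exp (((-Real.pi : ℝ) : ℂ) * Complex.I) = -(t : ℂ) := by
      rw [negativeAnchorTransfer_exp_neg_pi_mul_I, mul_neg_one]
    have hstart : ‖P.eval ((t : ℂ) * Complex.exp (((-Real.pi : ℝ) : ℂ) * Complex.I))‖ ≤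
        Real.exp (b (-Real.pi)) := by
      rw [hw₀, heval, hexpb, Real.cos_neg, Real.cos_pi, neg_add_cancel, mul_zero, Real.exp_zero,
        mul_one]
      calc ‖∑ n ∈ Finset.range (x + 1), (-(t : ℂ)) ^ Ωf f n‖
          ≤ C₀ * x * Real.log x ^ (-((k : ℝ) * (1 + t))) := hP x hx t ht ht2
        _ = C₀ * (x * Real.exp (L * ((k : ℝ) * (t * -1 - 1)))) := by
          rw [Real.rpow_def_of_pos hlog0, ← hLdef]
          have : L * -((k : ℝ) * (1 + t)) = L * ((k : ℝ) * (t * -1 - 1)) := by ring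
          rw [this]; ring
        _ ≤ C₀' * (x * Real.exp (L * ((k : ℝ) * (t * -1 - 1)))) :=
          mul_le_mul_of_nonneg_right hC₀C₀' (by positivity)
        _ = C₀' * x * Real.exp (L * ((k : ℝ) * (t * -1 - 1))) := (mul_assoc _ _ _).symm
    rcases him.eq_or_lt with him0 | himneg
    · -- `Im z = 0`: `z = -t` is the start of the arc itself
      have hzre : z = ((z.re : ℝ) : ℂ) := Complex.ext (by simp) (by simp [him0])
      have hre : t = -z.re := by
        have h := congr_arg norm hzre
        rw [Complex.norm_real, Real.norm_eq_abs, abs_of_nonpos hz1] at h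
        rwa [htdef]
      have hre' : z.re = -t := by linarith
      have hzt : z = -(t : ℂ) := Complex.ext (by simp [hre']) (by simp [him0])
      have hS := hP x hx t ht ht2
      rw [Real.rpow_def_of_pos hlog0, ← hLdef, ← hzt] at hS
      refine negativeAnchorTransfer_norm_H_le k f hx0 z (hS.trans ?_)
      rw [← hLdef]
      have hexpeq : L * -((k : ℝ) * (1 + t)) = L * ((k : ℝ) * (z.re - 1)) := by rw [hre']; ring
      rw [hexpeq, mul_assoc]
      refine mul_le_mul_of_nonneg_right (hC₀C₀'.trans ?_) (by positivity)
      exact le_mul_of_one_le_right hC₀'0 hCpπ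
    · -- `Im z < 0`: polar form `z = t e^{iψ}`, `-π < ψ ≤ -π/2`
      set ψ := Complex.arg z with hψdef
      have hψ0 : -Real.pi < ψ := Complex.neg_pi_lt_arg z
      have hψ2 : ψ ≤ -(Real.pi / 2) := by
        by_contra h
        rcases Complex.neg_pi_div_two_lt_arg_iff.mp (not_le.mp h) with h1 | h1 <;> linarith
      have hzeq : (t : ℂ) * Complex.exp ((ψ : ℂ) * Complex.I) = z :=
        Complex.norm_mul_exp_arg_mul_I z
      have hcos : t * Real.cos ψ = z.re := Complex.norm_mul_cos_arg z
      have hsin : t * Real.sin ψ = z.im := Complex.norm_mul_sin_arg z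
      -- the slope of the barrier dominates `-Im (w P'/P)` above the barrier
      have hstep : ∀ φ ∈ Set.Ioo (-Real.pi) ψ,
          Real.exp (b φ) < ‖P.eval ((t : ℂ) * Complex.exp ((φ : ℂ) * Complex.I))‖ →
            -(((t : ℂ) * Complex.exp ((φ : ℂ) * Complex.I) *
                (derivative P).eval ((t : ℂ) * Complex.exp ((φ : ℂ) * Complex.I)) /
                P.eval ((t : ℂ) * Complex.exp ((φ : ℂ) * Complex.I))).im) ≤ b' φ := by
        intro φ hφ hlt
        obtain ⟨hφ0, hφψ⟩ := hφ
        rw [hderiv, heval]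
        rw [heval] at hlt
        have hφneg : φ < 0 := by linarith [Real.pi_pos]
        have hφabs : |φ| = -φ := abs_of_neg hφneg
        have hφ1 : Real.pi / 2 ≤ |φ| := by rw [hφabs]; linarith
        have hφ2 : |φ| ≤ Real.pi := by rw [hφabs]; linarith
        obtain ⟨hsinle, hsinφ0⟩ := negativeAnchorTransfer_sin hφ0 hφψ.le hψ2
        have hts : |t * Real.sin φ| < η := by
          rw [abs_of_nonpos (mul_nonpos_of_nonneg_of_nonpos ht.le hsinφ0)]
          calc -(t * Real.sin φ) ≤ -(t * Real.sin ψ) :=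
                neg_le_neg (mul_le_mul_of_nonneg_left hsinle ht.le)
            _ = -z.im := by rw [hsin]
            _ = |z.im| := (abs_of_neg himneg).symm
            _ < η := hzim
        -- the proviso of the phase-velocity upper bound holds above the barrier
        have hprov : Real.exp (-K) * x * Real.log x ^ ((k : ℝ) * (t * Real.cos φ - 1)) ≤
            ‖∑ n ∈ Finset.range (x + 1),
              ((t : ℂ) * Complex.exp ((φ : ℂ) * Complex.I)) ^ Ωf f n‖ := by
          refine le_trans ?_ hlt.le
          rw [hexpb, Real.rpow_def_of_pos hlog0, ← hLdef]
          have hK1 : Real.exp (-K) ≤ 1 := Real.exp_le_one_iff.mpr (by linarith)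
          have hC1 : 1 ≤ Real.exp (Cp * (φ + Real.pi)) :=
            Real.one_le_exp (mul_nonneg hCp0 (by linarith))
          have hE := Real.exp_pos (L * ((k : ℝ) * (t * Real.cos φ - 1)))
          calc Real.exp (-K) * x * Real.exp (L * ((k : ℝ) * (t * Real.cos φ - 1)))
              ≤ 1 * x * Real.exp (L * ((k : ℝ) * (t * Real.cos φ - 1))) := by gcongr
            _ = 1 * x * Real.exp (L * ((k : ℝ) * (t * Real.cos φ - 1))) * 1 := (mul_one _).symm
            _ ≤ C₀' * x * Real.exp (L * ((k : ℝ) * (t * Real.cos φ - 1))) *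
                  Real.exp (Cp * (φ + Real.pi)) := by gcongr
        have hmain := hUB x hx t φ ht ht2 hφ1 hφ2 hts hprov
        rw [Real.sign_of_neg hφneg, neg_one_mul, abs_of_nonpos hsinφ0, ← hLdef] at hmain
        simp only [hb'def]
        linarith
      -- the arc barrier, from `φ = -π` to `φ = ψ`, and back from S to H (`t cos ψ = Re z`)
      have key := hArc P t (-Real.pi) ψ b b' ht hψ0.le (fun φ _ => hbder φ) hstart hstep ψ
        ⟨hψ0.le, le_rfl⟩
      rw [heval, hzeq, hexpb] at key
      refine negativeAnchorTransfer_norm_H_le k f hx0 z (key.trans ?_)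
      rw [← hLdef, hcos]
      have hψπ : Real.exp (Cp * (ψ + Real.pi)) ≤ Real.exp (Cp * Real.pi) :=
        Real.exp_le_exp.mpr (mul_le_mul_of_nonneg_left (by linarith [Real.pi_pos]) hCp0)
      calc C₀' * x * Real.exp (L * ((k : ℝ) * (z.re - 1))) * Real.exp (Cp * (ψ + Real.pi))
          = C₀' * Real.exp (Cp * (ψ + Real.pi)) * (x * Real.exp (L * ((k : ℝ) * (z.re - 1)))) := by
            ring
        _ ≤ C₀' * Real.exp (Cp * Real.pi) * (x * Real.exp (L * ((k : ℝ) * (z.re - 1)))) :=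
            mul_le_mul_of_nonneg_right (mul_le_mul_of_nonneg_left hψπ hC₀'0) (by positivity)
  -- conclusion: `z ≠ 0` is `key`; `z = 0` by continuity along the negative real axis
  intro z hz0 hz1 hzim
  rcases eq_or_ne z 0 with rfl | hz
  · have hcont : Continuous fun s : ℝ => ‖H k f x (s : ℂ)‖ :=
      ((negativeAnchorTransfer_continuous_H k f x).comp Complex.continuous_ofReal).norm
    have htend : Tendsto (fun s : ℝ => ‖H k f x (s : ℂ)‖) (𝓝[<] 0) (𝓝 ‖H k f x 0‖) :=
      tendsto_nhdsWithin_of_tendsto_nhds (by simpa using hcont.tendsto 0)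
    refine le_of_tendsto htend ?_
    filter_upwards [Ioo_mem_nhdsLT (show -η < (0 : ℝ) by linarith)] with s hs
    exact key (s : ℂ) (Complex.ofReal_ne_zero.mpr hs.2.ne) (by simpa using hs.1)
      (by simpa using hs.2.le) (by simpa using hη)
  · exact key z hz hz0 hz1 hzim

end

end Summit.Parity.BatemanHorn.Cruxes.NormalFamilyBound.RenewalPhaseBootstrap
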